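import Literature.MathematicalPhysics.QuantumFieldTheory.Balaban1983to89.B15LeafKnit

/-!
# `Balaban1983to89.B15LeafKnitExp` — [Balaban1989LargeFieldI] (0.5)–(0.6) p. 176 at the N12 knit: the exponents `Σ_X 𝐑(X, V)` PINNED
# to the logarithm of the (0.5)-quotient sums ((0.6) then PROVED from the p. 176 provisos alone), and the leaf at the TRIVIAL large-field
# decomposition (what the typed (0.4)∕(0.6) conjuncts do and do not constrain)

statement-level skeleton of published theorems with citation tags; proofs where landed; nothing here is a claim about
the Yang–Mills mass gap.

TRACK-A KNIT MODULE, companion of `B15LeafKnit` (HUMAN RULING D-0062; seat `pub-ymgap-dag-n12-a`; `bears_on: R4∕N12`).  PDF held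
`paper:balaban1989-cmp122-large-field-i` (journal page = PDF page + 174).

WHAT THIS FILE PROVES (0 `sorry`, axioms standard; two small definitions `KnitData.logExp`, `KnitData.trivial`).
* `quot03_knit_pos`, `quotSum_knit_pos` — at the datum of record `knitRData`, the (0.3)-quotients and the (0.5)-sums over the OCCURRING
  regions `Z″` are POSITIVE once every piece's fibre integrals `∫dV⌈_{Z′}ρ(Z, V)`, `∫dV⌈_{Z′}ρ(Z″, V)` vanish nowhere (p. 176: *"the
  densities are positive … hence the denominators are positive"*).
* `KnitData.logExp` — the record with the exponent attached to `Z″` PINNED to `log` of the (0.5)-sum: this IS what (0.5) says the number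
  `Σ_X 𝐑(X, V)` equals (*"Σ_{Z′⊂Z″ᶜ} ∫dV⌈_{Z′}ρ(Z′∪Z″, V) / ∫dV⌈_{Z′}ρ(Z″, V) = exp Σ_X 𝐑(X, V)"*); `hyp05Image_logExp` — (0.5) on the
  occurring regions then HOLDS (`Real.exp_log`); `b15Leaf_knit_logExp_of` — the B15 leaf at `knitW15 κ.logExp` with (0.4) AND (0.6) PROVED
  from the p. 176 provisos, displaying only Proposition 1, (1.80), (1.89), (1.102).  LOCATED TYPING OBSERVATION (for the referee's
  vacuity audit, not a claim about print): the typed shape `B15.ExpForm06` reads the exponent only as ONE number per `Z″`, so the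
  polymer structure of (0.5) (*"the last sum is over X such, that X∩Z″ᶜ ≠ ∅"*, localization and bounds — [Balaban1989LargeFieldII]) is
  NOT expressible in the leaf; as typed, (0.6) carries no content beyond the positivity of the quotients.
* `KnitData.trivial`, `b15Leaf_knit_trivial_iff` — at the TRIVIAL decomposition (ONE region, empty new part `Z′ = ∅`, piece `1`: the
  step at which 𝐑 integrates nothing) the provisos hold outright (`fibreIntegral ∅ 1 = 1`) and the leaf `B15Leaf (knitW15 …)` is EXACTLY
  the four displayed printed statements — the knit's own hypotheses smuggle nothing, and the (0.4)∕(0.6) conjuncts AS TYPED do not tie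
  the decomposition to the other four conjuncts (each conjunct of `PrintedCarriers15` has its own carriers).
HONEST FRAMING: bookkeeping over `B15LeafKnit` and r12's theorems by name; count-neutral; NOT a node discharge; one finite four-torus
programme at fixed ε; NOT continuum ∕ ℝ⁴ ∕ OS ∕ mass gap ∕ Clay.
-/

noncomputable section

open scoped BigOperators ENNReal
open MeasureTheory

namespace Literature.MathematicalPhysics.QuantumFieldTheory.Balaban1983to89.B15LeafKnitExp

open DagBinding
open B15 (RData Rop Normalization04 ExpForm06 Prop1Printed Ineq180)
open B15.BasicStep (fibreIntegral Claim189)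
open B15Eq06Resum (quot03 quotSum)
open B15Sect1Statements (RPrimeData rPrime1100 Normalization1102)
open B15Claim189Assembly (Setting189 new189 chiPP dom)
open B15Norm1102Object (fibreIntegral_nonneg)
open B8Eq17ClassAkV1 (plaqsOf)
open B15LeafKnit (knitRData KnitData knitW15 integral_fibreIntegral_pos b15Leaf_knit_of)

/-! ## §1. Positivity of the (0.3)-quotients and (0.5)-sums at the datum of record -/

section Pos

variable {P : Params} {k : ℕ} {G : Type} [GaugeGroup G] [MeasurableSpace G] [HaarData G] [DecidableEq (PBond P k)]
variable {R : Type} [Fintype R]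

/-- The (0.3)-quotient `∫dV⌈_{Z′}ρ(Z,V) / ∫dV⌈_{Z′}ρ(Z″,V)` of the datum of record is POSITIVE when both fibre integrals vanish nowhere
(p. 176 provisos). [cite: Balaban1989LargeFieldI, (0.3) p.176] -/
theorem quot03_knit_pos (piece : R → Density P k G) (pp : R → R) (fib : R → Finset (PBond P k))
    (hm : ∀ Z, Measurable (piece Z)) (h0 : ∀ Z V, 0 ≤ piece Z V) {C : ℝ} (hC : ∀ Z V, piece Z V ≤ C)
    (hnum : ∀ Z V, fibreIntegral (fib Z) (piece Z) V ≠ 0) (hden : ∀ Z V, fibreIntegral (fib Z) (piece (pp Z)) V ≠ 0) (Z : R) :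
    0 < quot03 (knitRData piece pp fib) Z :=
  div_pos (integral_fibreIntegral_pos (fib Z) (hm Z) (h0 Z) (hC Z) (hnum Z))
    (integral_fibreIntegral_pos (fib Z) (hm _) (h0 _) (hC _) (hden Z))

open Classical in
/-- The (0.5)-sum of an OCCURRING region `Z″ = W` is POSITIVE under the p. 176 provisos (a non-empty sum of positive quotients).
[cite: Balaban1989LargeFieldI, (0.5) p.176] -/
theorem quotSum_knit_pos (piece : R → Density P k G) (pp : R → R) (fib : R → Finset (PBond P k))
    (hm : ∀ Z, Measurable (piece Z)) (h0 : ∀ Z V, 0 ≤ piece Z V) {C : ℝ} (hC : ∀ Z V, piece Z V ≤ C)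
    (hnum : ∀ Z V, fibreIntegral (fib Z) (piece Z) V ≠ 0) (hden : ∀ Z V, fibreIntegral (fib Z) (piece (pp Z)) V ≠ 0)
    {W : R} (hW : ∃ Z, pp Z = W) : 0 < quotSum (knitRData piece pp fib) W := by
  obtain ⟨Z₀, hZ₀⟩ := hW
  unfold quotSum
  refine Finset.sum_pos (fun Z _ => quot03_knit_pos piece pp fib hm h0 hC hnum hden Z) ⟨Z₀, ?_⟩
  exact Finset.mem_filter.2 ⟨Finset.mem_univ _, hZ₀⟩

omit [DecidableEq (PBond P k)] [Fintype R] in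
open Classical in
/-- Over a ONE-REGION index the (0.5)-sum at the region is its own (0.3)-quotient. [cite: Balaban1989LargeFieldI, (0.5) p.176 (bookkeeping)] -/
theorem quotSum_eq_quot03_of_subsingleton (D : RData) [Subsingleton D.Reg] (W : D.Reg) : quotSum D W = quot03 D W := by
  unfold quotSum
  have hmem : W ∈ Finset.univ.filter (fun Z => D.Zpp Z = W) :=
    Finset.mem_filter.2 ⟨Finset.mem_univ _, Subsingleton.elim _ _⟩
  exact Finset.sum_eq_single_of_mem W hmem (fun Z _ hZ => absurd (Subsingleton.elim Z W) hZ)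

end Pos

/-! ## §2. The exponents pinned to the logarithm of the (0.5)-sums: (0.6) PROVED -/

section LogExp

variable {P : Params} {k : ℕ} {G : Type} [GaugeGroup G] [MeasurableSpace G] [HaarData G] [DecidableEq (PBond P k)]
variable {R : Type} [Fintype R] [DecidableEq R] {P₀ : Params} {C ι : Type}

/-- **The record with the exponent of (0.5) PINNED**: `Σ_X 𝐑(X, V)` attached to `Z″` := `log` of the (0.5)-quotient sum at `Z″` — the
number (0.5) says it is. [cite: Balaban1989LargeFieldI, (0.5) p.176] -/
def _root_.Literature.MathematicalPhysics.QuantumFieldTheory.Balaban1983to89.B15LeafKnit.KnitData.logExp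
    (κ : KnitData P k G R P₀ C ι) : KnitData P k G R P₀ C ι :=
  { κ with Rexp := fun W => Real.log (quotSum κ.rdata W) }

variable (κ : KnitData P k G R P₀ C ι)

/-- **(0.5) on the occurring regions HOLDS for the pinned exponents** under the p. 176 provisos (`exp (log q) = q` for `q > 0`).
[cite: Balaban1989LargeFieldI, (0.5) p.176] -/
theorem hyp05Image_logExp (hm : ∀ Z, Measurable (κ.piece Z)) (h0 : ∀ Z V, 0 ≤ κ.piece Z V) {Cρ : ℝ}
    (hC : ∀ Z V, κ.piece Z V ≤ Cρ) (hnum : ∀ Z V, fibreIntegral (κ.fib Z) (κ.piece Z) V ≠ 0)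
    (hden : ∀ Z V, fibreIntegral (κ.fib Z) (κ.piece (κ.pp Z)) V ≠ 0) :
    ∀ W ∈ Finset.univ.image κ.logExp.pp, quotSum κ.logExp.rdata W = Real.exp (κ.logExp.Rexp W) := by
  intro W hW
  obtain ⟨Z, _, hZ⟩ := Finset.mem_image.1 hW
  exact (Real.exp_log (quotSum_knit_pos κ.piece κ.pp κ.fib hm h0 hC hnum hden ⟨Z, hZ⟩)).symm

/-- **THE B15 LEAF AT THE PINNED BUNDLE WITH PINNED EXPONENTS** — `B15Leaf (knitW15 κ.logExp)`: (0.4) AND (0.6) PROVED from the p. 176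
provisos (pieces measurable, nonnegative, bounded; all fibre integrals nowhere zero); DISPLAYED: Proposition 1 (1.78), (1.80) on the
ℍ-domains of (1.89), (1.89), (1.102). [cite: Balaban1989LargeFieldI, (0.4)–(0.6) p.176, Prop. 1 (1.78) p.194, (1.80) p.195, (1.89) p.198, (1.102) p.201] -/
theorem b15Leaf_knit_logExp_of (hm : ∀ Z, Measurable (κ.piece Z)) (h0 : ∀ Z V, 0 ≤ κ.piece Z V) {Cρ : ℝ}
    (hC : ∀ Z V, κ.piece Z V ≤ Cρ) (hnum : ∀ Z V, fibreIntegral (κ.fib Z) (κ.piece Z) V ≠ 0)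
    (hden : ∀ Z V, fibreIntegral (κ.fib Z) (κ.piece (κ.pp Z)) V ≠ 0)
    (hP1 : Prop1Printed κ.LF)
    (h180 : ∀ U, new189 κ.D189 U → ∀ j, κ.D189.h ≤ j → j ≤ κ.D189.k → ∀ p ∈ plaqsOf (dom κ.D189 j),
      Ineq180 (κ.D189.dev0 U p) (κ.D189.ε κ.D189.k) κ.D189.η κ.D189.B₃ κ.D189.B₅ κ.D189.M κ.D189.δ (κ.D189.dist p) κ.D189.O1)
    (h189 : Claim189 (new189 κ.D189) (chiPP κ.D189)) (h1102 : Normalization1102 κ.D1100 κ.ρk) :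
    B15Leaf (knitW15 κ.logExp) :=
  b15Leaf_knit_of κ.logExp hm h0 hC hden (hyp05Image_logExp κ hm h0 hC hnum hden) hP1 h180 h189 h1102

end LogExp

/-! ## §3. The leaf at the TRIVIAL large-field decomposition -/

section Trivial

variable {P : Params} {k : ℕ} {G : Type} [GaugeGroup G] [MeasurableSpace G] [HaarData G] [DecidableEq (PBond P k)]
variable {P₀ : Params} {C ι : Type}

/-- **The TRIVIAL large-field decomposition**: ONE region (`R := Unit`) with empty new part (`Z′ = ∅`: nothing is integrated, the 𝐑 step
is the identity), piece `ρ(Z, ·) := 1`, exponent `0`; the Proposition-1 carrier, the (1.89) data, the (1.100) data and `ρ_k` as given.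
[cite: Balaban1989LargeFieldI, (0.2) p.176 (degenerate instance, bookkeeping)] -/
def _root_.Literature.MathematicalPhysics.QuantumFieldTheory.Balaban1983to89.B15LeafKnit.KnitData.trivial
    (LF : B15.LFVar) (D189 : Setting189 P₀ G C ι) (D1100 : RPrimeData P k G) (ρk : Density P k G) :
    KnitData P k G Unit P₀ C ι where
  piece := fun _ _ => 1
  pp := id
  fib := fun _ => ∅
  Rexp := fun _ => 0
  LF := LF
  D189 := D189
  D1100 := D1100
  ρk := ρk

omit [GaugeGroup G] [HaarData G] in
/-- `∫dV⌈_∅ 1 = 1`: the fibre integral over NO variables of the constant piece. [folklore] -/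
private theorem fibreIntegral_empty_one [GaugeGroup G] [HaarData G] (V : GaugeField P k G) :
    fibreIntegral (∅ : Finset (PBond P k)) (fun _ : GaugeField P k G => (1 : ℝ)) V = 1 := by
  simp [fibreIntegral, lmarginal_empty]

/-- **At the trivial decomposition the B15 leaf is EXACTLY the four displayed printed statements** — Proposition 1 (1.78), (1.80) on the
ℍ-domains, (1.89), (1.102): the p. 176 provisos hold outright, (0.4) and (0.6) are proved (exponent `0 = log 1`).
[cite: Balaban1989LargeFieldI, Prop. 1 (1.78) p.194, (1.80) p.195, (1.89) p.198, (1.102) p.201] -/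
theorem b15Leaf_knit_trivial_iff (LF : B15.LFVar) (D189 : Setting189 P₀ G C ι) (D1100 : RPrimeData P k G) (ρk : Density P k G) :
    B15Leaf (knitW15 (KnitData.trivial LF D189 D1100 ρk)) ↔
      (Prop1Printed LF ∧
      (∀ U, new189 D189 U → ∀ j, D189.h ≤ j → j ≤ D189.k → ∀ p ∈ plaqsOf (dom D189 j),
        Ineq180 (D189.dev0 U p) (D189.ε D189.k) D189.η D189.B₃ D189.B₅ D189.M D189.δ (D189.dist p) D189.O1) ∧
      Claim189 (new189 D189) (chiPP D189) ∧ Normalization1102 D1100 ρk) := by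
  set κ : KnitData P k G Unit P₀ C ι := KnitData.trivial LF D189 D1100 ρk with hκ
  have hm : ∀ Z, Measurable (κ.piece Z) := fun _ => measurable_const
  have h0 : ∀ Z V, 0 ≤ κ.piece Z V := fun _ _ => zero_le_one
  have hC : ∀ Z V, κ.piece Z V ≤ 1 := fun _ _ => le_rfl
  have hone : ∀ Z V, fibreIntegral (κ.fib Z) (κ.piece Z) V = 1 := fun _ V => fibreIntegral_empty_one V
  have hnum : ∀ Z V, fibreIntegral (κ.fib Z) (κ.piece Z) V ≠ 0 := fun Z V => by rw [hone Z V]; exact one_ne_zero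
  have hden : ∀ Z V, fibreIntegral (κ.fib Z) (κ.piece (κ.pp Z)) V ≠ 0 := fun Z V => hnum Z V
  -- the (0.5)-sum of the one region is `1 = exp 0`
  have h05 : ∀ W ∈ Finset.univ.image κ.pp, quotSum κ.rdata W = Real.exp (κ.Rexp W) := by
    intro W _
    have hq : quot03 κ.rdata W = 1 := by
      -- numerator and denominator are the same number `∫dV ∫dV⌈_∅ 1 = 1`
      show (∫ V, fibreIntegral (κ.fib W) (κ.piece W) V ∂(fieldMeasure P k G)) /
          (∫ V, fibreIntegral (κ.fib W) (κ.piece W) V ∂(fieldMeasure P k G)) = 1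
      have h1 : (∫ V, fibreIntegral (κ.fib W) (κ.piece W) V ∂(fieldMeasure P k G)) = 1 := by
        simp_rw [hone W]; simp
      rw [h1, div_one]
    have hsum : quotSum κ.rdata W = quot03 κ.rdata W := quotSum_eq_quot03_of_subsingleton κ.rdata W
    rw [hsum, hq]
    show (1 : ℝ) = Real.exp 0
    rw [Real.exp_zero]
  constructor
  · intro h
    exact B15LeafKnit.slots_of_b15Leaf_knit κ h
  · rintro ⟨hP1, h180, h189, h1102⟩
    exact b15Leaf_knit_of κ hm h0 hC hden h05 hP1 h180 h189 h1102

end Trivial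

end Literature.MathematicalPhysics.QuantumFieldTheory.Balaban1983to89.B15LeafKnitExp

end
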